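import Summits.CriticalPhenomena.PercolationContinuityZ3.Theorems.PercNearOneGluingNoHeavyLowerTailFKCSHUnfold
import Summits.CriticalPhenomena.PercolationContinuityZ3.Theorems.PercNearOneGluingNoHeavyLowerTailFKCSHInduction
import Summits.CriticalPhenomena.PercolationContinuityZ3.Theorems.PercNearOneGluingAdditiveGluingCSHHtwBridge
import Summits.CriticalPhenomena.PercolationContinuityZ3.Theorems.PercNearOneGluingNoHeavyLowerTailFKCSHPeelDefs
import HarnessLib

/-!
# FK sub-lane: Lemma U_FK, file 4 — THE UNFOLDING IDENTITY for `φ_{w,q}`, the within-margin from the lower levels, and the assembly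
# `FK.PhiFKMonotone q → FK.HpartFK q → FK.CSHFK q` (`q ≥ 1`)

Support / definitions file (`--supports stmt-CriticalPhenomena-4575`), FK sub-lane `prim-bschramm-fk-1` (gen 2) of the post-continuity
programme; builds on p205010 (kernel theorem, internal audit signed; external expert review pending).  No named facts, no sorries; standard
axioms.  Fourth file of the port plan bschramm/FK-DEFS.md §6.3 (prim-ineq-prove-1's `…NoHeavyLowerTailCSHUnfoldMain.lean` for the
random-cluster measure) and the assembly.

* `FK.within_unfold_rc` — **LEMMA U FOR `φ_{w,q}`** (identity): the `{x↮Y}`-integral of the level-form margin of the FK world covariances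
  `u ↦ Cov_{φ^ω}(g(C_x), 1{x↔u})` (verbatim the integrand of `hU` of `FK.cshFK_of_unfold`) = H-part + `subTFK(o) − p·subTFK(v)`;
* `FK.subTFK_comb_nonneg`, `FK.within_nonneg_of_hpart_rc` — the within-margin is `≥ 0` given the lower levels, the H-part and the
  monotonicity of `Φ_FK` (hypothesis);
* `FK.HpartFK q` — LEMMA H for `φ_{w,q}` as a statement (parametrised by `q`, NOT asserted; `q > 1`: (K6)_rc tree + (Htw)_FK open);
* `FK.hpartFK_one : HpartFK 1` (png-lead's `CSH.hpart_nonneg`, q = 1 sanity);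
* **`FK.cshFK_of_hpartFK_of_phiFKMonotone : 1 ≤ q → FK.PhiFKMonotone q → FK.HpartFK q → FK.CSHFK q`** — memo Theorem 1 for the
  random-cluster measure from the two located statements; with fk-1's `FK.additiveGluingFK_of_cshFK` this gives `FK.AdditiveGluingFK q`.
So the FK finite leg for `q ≥ 1` is, in Lean: `AdditiveGluingFK q ⟸ CSHFK q ⟸ PhiFKMonotone q ∧ HpartFK q` — everything else (Lemma T_rc,
MDL(X)_FK, the induction, Lemma U_FK, the peeling, the upper chain) is kernel-checked.
[cite: VandenbergHaggstromKahn2005, §2.1 (pp. 9–13), Thm. 1.4 (p. 7)] [cite: KozmaNitzan2024, Conj. 4 (p. 32)] [cite: Grimmett2006, §1.4 eq. (1.20) (p. 15)]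
-/

noncomputable section

namespace Summit.CriticalPhenomena.PercolationContinuityZ3.Theorems

open MeasureTheory Set Literature.Probability.LatticeModels Literature.Probability.Percolation
open scoped Classical
open BHK2006 DecisionTree HullPort

namespace FK

variable {V : Type*} [Fintype V]

/-! ### LEMMA U FOR `φ_{w,q}`: the unfolding identity -/

/-- **LEMMA U FOR `φ_{w,q}`, GENERAL `k`** (memo §3.3 for the random-cluster measure, `q > 0`, non-degenerate parameters): the `{x↮Y}`-integral of
the level-form margin of the FK world covariances `u ↦ Cov_{φ^ω}(g(C_x), 1{x↔u})` (verbatim the integrand of the hypothesis `hU` of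
`FK.cshFK_of_unfold`, worlds `φ^ω = rcMeasureW (delW w A_Y(ω)) q ∅`) EQUALS the H-part (world covariances with the set indicators
`1{o ↔ {x}∪D}`, `1{v ↔ {x}∪D}`) plus `subTFK(o) − p·subTFK(v)` (the accumulated lower-level margins at the functionals `Φ̃_d` of `Φ_FK`).
(`CSH.within_unfold` for the random-cluster measure.) [cite: VandenbergHaggstromKahn2005, §2.1 Lemmas 2.3–2.4 (p. 10) — corollaries] -/
theorem within_unfold_rc (w : Sym2 V → unitInterval) {q : ℝ} (hq : 0 < q) (hw : ∀ e, 0 < w e ∧ w e < 1) (x : V) (Y : Set V)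
    (D : List V) (o v : V) (hnd : D.Nodup) (hD : ∀ d ∈ D, d ≠ x ∧ d ∉ Y ∧ d ≠ o ∧ d ≠ v) (g : Set (Sym2 V) → ℝ) (p : ℝ) :
    ∫ ω in {ω : BondConfig V | ∀ y ∈ Y, ¬ (openGraph ω).Reachable x y},
        CSH.cshMarg (decoyListμ (rcMeasureW w q ∅) (insert x Y) D) p o v
          (fun u => (∫ η in (openConn x u : Set (BondConfig V)), g (openEdgeCluster η x)
                ∂(rcMeasureW (delW w {e | ∃ z ∈ e, ∃ y ∈ Y, (openGraph ω).Reachable y z}) q ∅)) -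
              (∫ η, g (openEdgeCluster η x)
                ∂(rcMeasureW (delW w {e | ∃ z ∈ e, ∃ y ∈ Y, (openGraph ω).Reachable y z}) q ∅)) *
              (rcMeasureW (delW w {e | ∃ z ∈ e, ∃ y ∈ Y, (openGraph ω).Reachable y z}) q ∅).real
                (openConn x u : Set (BondConfig V)))
        ∂(rcMeasureW w q ∅) =
      (∫ ω in {ω : BondConfig V | ∀ y ∈ Y, ¬ (openGraph ω).Reachable x y},
        (((∫ η in (⋃ t ∈ insert x D.toFinset, openConn o t), g (openEdgeCluster η x)
              ∂(rcMeasureW (delW w {e | ∃ z ∈ e, ∃ y ∈ Y, (openGraph ω).Reachable y z}) q ∅)) -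
            (rcMeasureW (delW w {e | ∃ z ∈ e, ∃ y ∈ Y, (openGraph ω).Reachable y z}) q ∅).real
                (⋃ t ∈ insert x D.toFinset, openConn o t) *
              (∫ η, g (openEdgeCluster η x)
                ∂(rcMeasureW (delW w {e | ∃ z ∈ e, ∃ y ∈ Y, (openGraph ω).Reachable y z}) q ∅))) -
          p * ((∫ η in (⋃ t ∈ insert x D.toFinset, openConn v t), g (openEdgeCluster η x)
              ∂(rcMeasureW (delW w {e | ∃ z ∈ e, ∃ y ∈ Y, (openGraph ω).Reachable y z}) q ∅)) -
            (rcMeasureW (delW w {e | ∃ z ∈ e, ∃ y ∈ Y, (openGraph ω).Reachable y z}) q ∅).real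
                (⋃ t ∈ insert x D.toFinset, openConn v t) *
              (∫ η, g (openEdgeCluster η x)
                ∂(rcMeasureW (delW w {e | ∃ z ∈ e, ∃ y ∈ Y, (openGraph ω).Reachable y z}) q ∅))))
        ∂(rcMeasureW w q ∅)) +
      (subTFK w q x Y g o {x} D - p * subTFK w q x Y g v {x} D) := by
  classical
  set φm := rcMeasureW w q ∅ with hφm
  set L := decoyListμ φm (insert x Y) D with hLdef
  set G : Set (Sym2 V) → ℝ := fun β => g (openEdgeCluster β x) with hG
  have hDev : {ω : BondConfig V | ∀ y ∈ Y, ¬ (openGraph ω).Reachable x y} = avoidEv x Y := rfl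
  have hL' : L = decoyListμ φm ({x} ∪ Y) D := by rw [hLdef, ← Set.insert_eq]
  have hdecs : {d : V | d ∈ L.map Prod.fst} = {d | d ∈ D} := by rw [hLdef, map_fst_decoyListμ]
  set Sset : Set V := {x} ∪ {d | d ∈ D} with hSset
  have hSfin : (↑(insert x D.toFinset) : Set V) = Sset := by
    ext u; simp [hSset]
  set Jf : V → Set (Sym2 V) → ℝ := fun u ζ => CSH.jn (openGraph ζ).Reachable Sset u with hJf
  set Tf : V → Set (Sym2 V) → ℝ := fun u ζ => CSH.unfoldT (openGraph ζ).Reachable {x} L u with hTf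
  -- Step A: the integrand is a world covariance margin (sum vocabulary)
  rw [hDev, setIntegral_rcMeasureW_eq_sum w hq, setIntegral_rcMeasureW_eq_sum w hq]
  simp only [world_cov_eq_wcov w hq, world_cov_eq_wcov' w hq]
  -- Step B: pointwise unfolding of the margin of the world covariances
  have stepB : ∀ ω, CSH.cshMarg L p o v (fun u => wcov w q Y G (ind (openConn x u : Set (BondConfig V))) ω) =
      wcov w q Y G (Jf o) ω - p * wcov w q Y G (Jf v) ω - wcov w q Y G (Tf o) ω + p * wcov w q Y G (Tf v) ω := by
    intro ω
    rw [CSH.cshMarg_eq_sum_single, ← wcov_finset_sum_mul]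
    have inner : (fun ζ => ∑ u, CSH.cshMarg L p o v (Pi.single u (1 : ℝ)) * ind (openConn x u : Set (BondConfig V)) ζ) =
        fun ζ => (Jf o ζ - p * Jf v ζ) - (Tf o ζ - p * Tf v ζ) + (CSH.unfoldK L o - p * CSH.unfoldK L v) := by
      funext ζ
      rw [← CSH.cshMarg_eq_sum_single L p o v (fun u => ind (openConn x u : Set (BondConfig V)) ζ),
        CSH.ind_openConn_eq_jn_singleton]
      simp only [CSH.cshMarg, CSH.slForm_jn (openGraph ζ).Reachable (fun a b h => h.symm) (fun a b c h h' => h.trans h') L {x},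
        hdecs, hJf, hTf, hSset]
      ring
    rw [inner, wcov_affine w hq]
  -- Step C: sum over ω; the `unfoldT` parts are `−subTFK`
  have hDo : ∀ d ∈ D, d ∉ ({x} : Set V) ∧ d ∉ Y ∧ d ≠ o := fun d hd =>
    ⟨fun h => (hD d hd).1 (Set.mem_singleton_iff.1 h), (hD d hd).2.1, (hD d hd).2.2.1⟩
  have hDv : ∀ d ∈ D, d ∉ ({x} : Set V) ∧ d ∉ Y ∧ d ≠ v := fun d hd =>
    ⟨fun h => (hD d hd).1 (Set.mem_singleton_iff.1 h), (hD d hd).2.1, (hD d hd).2.2.2⟩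
  have stepCo := sum_wcov_unfoldT_rc w hq hw x Y g o D {x} (Set.mem_singleton x) hnd hDo
  have stepCv := sum_wcov_unfoldT_rc w hq hw x Y g v D {x} (Set.mem_singleton x) hnd hDv
  rw [← hL'] at stepCo stepCv
  have e : ∀ ω, rcMass w q ω * (CSH.cshMarg L p o v (fun u => wcov w q Y G (ind (openConn x u : Set (BondConfig V))) ω) *
      ind (avoidEv x Y) ω) =
      rcMass w q ω * (ind (avoidEv x Y) ω * (wcov w q Y G (Jf o) ω - p * wcov w q Y G (Jf v) ω)) -
        rcMass w q ω * (ind (avoidEv x Y) ω * wcov w q Y G (Tf o) ω) +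
        p * (rcMass w q ω * (ind (avoidEv x Y) ω * wcov w q Y G (Tf v) ω)) := by
    intro ω; rw [stepB ω]; ring
  rw [Finset.sum_congr rfl (fun ω _ => e ω), Finset.sum_add_distrib, Finset.sum_sub_distrib, ← Finset.mul_sum]
  change (∑ ω, rcMass w q ω * (ind (avoidEv x Y) ω * (wcov w q Y G (Jf o) ω - p * wcov w q Y G (Jf v) ω))) -
      (∑ ω, rcMass w q ω * (ind (avoidEv x Y) ω * wcov w q Y G
        (fun ζ => CSH.unfoldT (openGraph ζ).Reachable {x} L o) ω)) +
      p * (∑ ω, rcMass w q ω * (ind (avoidEv x Y) ω * wcov w q Y G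
        (fun ζ => CSH.unfoldT (openGraph ζ).Reachable {x} L v) ω)) = _
  rw [stepCo, stepCv]
  -- Step D: the H-part back in measure form
  have hJ : ∀ u, Jf u = ind (⋃ t ∈ insert x D.toFinset, (openConn u t : Set (BondConfig V))) := by
    intro u; funext ζ
    rw [hJf]
    dsimp only
    rw [CSH.jn_reachable_eq_ind, ← CSH.setOf_exists_reachable_eq_iUnion, hSfin]
  have eH : ∀ ω, rcMass w q ω * (ind (avoidEv x Y) ω * (wcov w q Y G (Jf o) ω - p * wcov w q Y G (Jf v) ω)) =
      rcMass w q ω * ((wcov w q Y G (ind (⋃ t ∈ insert x D.toFinset, (openConn o t : Set (BondConfig V)))) ω -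
          p * wcov w q Y G (ind (⋃ t ∈ insert x D.toFinset, (openConn v t : Set (BondConfig V)))) ω) * ind (avoidEv x Y) ω) := by
    intro ω; rw [hJ o, hJ v]; ring
  rw [Finset.sum_congr rfl (fun ω _ => eH ω)]
  ring

/-! ### The lower-level terms are nonnegative given the lower levels and `PhiFKMonotone` -/

/-- **`subTFK(o) − p·subTFK(v) ≥ 0` from the lower levels** (memo §3.5 for `φ_{w,q}`, `q ≥ 1`): along the splittings `D₀ = pre ++ rest`,
each term is `φ(E_d)⁻¹ · cshMarginμ φ d ({x}∪Y∪pre_d) rest_{>d} o v Φ̃_d`, nonnegative when the lower-level margins at the monotone nonnegative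
functionals `Φ̃_d` are (hypothesis `hIH`) — monotone BY THE HYPOTHESIS `hΦ` (`FK.PhiFKMonotone` at this vertex type).
(`CSH.subT_comb_nonneg` for the random-cluster measure) [cite: KozmaNitzan2024, Conj. 4 (p. 32)] -/
theorem subTFK_comb_nonneg (w : Sym2 V → unitInterval) {q : ℝ} (hq : 1 ≤ q) (x : V) (Y : Set V) (D₀ : List V) (o v : V)
    {g : Set (Sym2 V) → ℝ} (hg : Monotone g) (hΦ : Monotone (phiFK w q x Y g))
    (hIH : ∀ (pre : List V) (d : V) (ds' : List V), D₀ = pre ++ d :: ds' →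
      ∀ h : Set (Sym2 V) → ℝ, Monotone h → (∀ C, 0 ≤ h C) →
        0 ≤ cshMarginμ (rcMeasureW w q ∅) d (insert x Y ∪ {e | e ∈ pre}) ds' o v h) :
    ∀ (rest pre : List V), D₀ = pre ++ rest →
      0 ≤ subTFK w q x Y g o ({x} ∪ {e | e ∈ pre}) rest -
        obsConstμ (rcMeasureW w q ∅) o v (insert x Y ∪ {d | d ∈ D₀}) * subTFK w q x Y g v ({x} ∪ {e | e ∈ pre}) rest := by
  intro rest
  induction rest with
  | nil => intro pre _; simp [subTFK]
  | cons d ds ih =>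
    intro pre hsplit
    set φm := rcMeasureW w q ∅ with hφm
    set A : Set V := {x} ∪ {e | e ∈ pre} ∪ Y with hA
    have hA' : A = insert x Y ∪ {e | e ∈ pre} := by
      ext u; simp only [hA, Set.mem_union, Set.mem_singleton_iff, Set.mem_setOf_eq, Set.mem_insert_iff]; tauto
    have hset : insert d A ∪ {e | e ∈ ds} = insert x Y ∪ {e | e ∈ D₀} := by
      ext u
      simp only [hA, hsplit, Set.mem_union, Set.mem_insert_iff, Set.mem_singleton_iff, Set.mem_setOf_eq, List.mem_append,
        List.mem_cons]
      tauto
    have hmargin : CSH.slForm (decoyListμ φm (insert d A) ds) (covDμ φm d A (phiTFK w q x Y g d)) o -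
        obsConstμ φm o v (insert x Y ∪ {e | e ∈ D₀}) *
          CSH.slForm (decoyListμ φm (insert d A) ds) (covDμ φm d A (phiTFK w q x Y g d)) v =
        cshMarginμ φm d (insert x Y ∪ {e | e ∈ pre}) ds o v (phiTFK w q x Y g d) := by
      rw [← hset, ← hA']; rfl
    have hhead : 0 ≤ cshMarginμ φm d (insert x Y ∪ {e | e ∈ pre}) ds o v (phiTFK w q x Y g d) :=
      hIH pre d ds hsplit (phiTFK w q x Y g d) (phiTFK_mono w q x Y g hΦ d) (fun K => phiTFK_nonneg w hq x Y hg d K)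
    have hinv : 0 ≤ (φm.real (avoidEv d A))⁻¹ := inv_nonneg.2 measureReal_nonneg
    have htail := ih (pre ++ [d]) (by rw [hsplit]; simp)
    have hS' : ({x} ∪ {e | e ∈ pre ++ [d]} : Set V) = insert d ({x} ∪ {e | e ∈ pre}) := by
      ext u
      simp only [Set.mem_union, Set.mem_singleton_iff, Set.mem_setOf_eq, List.mem_append, List.mem_singleton, Set.mem_insert_iff]
      tauto
    rw [hS'] at htail
    have hSY : ({x} ∪ {e | e ∈ pre} : Set V) ∪ Y = A := rfl
    simp only [subTFK, hSY]
    have key : (φm.real (avoidEv d A))⁻¹ *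
          CSH.slForm (decoyListμ φm (insert d A) ds) (covDμ φm d A (phiTFK w q x Y g d)) o +
        subTFK w q x Y g o (insert d ({x} ∪ {e | e ∈ pre})) ds -
        obsConstμ φm o v (insert x Y ∪ {d | d ∈ D₀}) *
          ((φm.real (avoidEv d A))⁻¹ *
              CSH.slForm (decoyListμ φm (insert d A) ds) (covDμ φm d A (phiTFK w q x Y g d)) v +
            subTFK w q x Y g v (insert d ({x} ∪ {e | e ∈ pre})) ds) =
        (φm.real (avoidEv d A))⁻¹ * cshMarginμ φm d (insert x Y ∪ {e | e ∈ pre}) ds o v (phiTFK w q x Y g d) +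
          (subTFK w q x Y g o (insert d ({x} ∪ {e | e ∈ pre})) ds -
            obsConstμ φm o v (insert x Y ∪ {d | d ∈ D₀}) * subTFK w q x Y g v (insert d ({x} ∪ {e | e ∈ pre})) ds) := by
      rw [← hmargin]; ring
    rw [key]
    exact add_nonneg (mul_nonneg hinv hhead) htail

/-- **The within-margin for `φ_{w,q}` is nonnegative given the lower levels, the H-part and `PhiFKMonotone`** — the hypothesis `hU` of
`FK.cshFK_of_unfold` modulo Lemma H_FK and the located open statement: for `q ≥ 1`, non-degenerate parameters, distinct data, `g` monotone,
`Φ_FK` monotone at this owner/avoided set (`hΦ`), `0 ≤ Hpart_FK` (`hHP`) and the lower-level margins nonnegative (`hIH`) imply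
`0 ≤ ∫_{x↮Y} Marg[u ↦ Cov_{φ^ω}(g(C_x), 1{x↔u})] dφ`. (`CSH.within_nonneg_of_hpart` for the random-cluster measure)
[cite: KozmaNitzan2024, Conj. 4 (p. 32)] [cite: VandenbergHaggstromKahn2005, §2.1 (pp. 9–13)] -/
theorem within_nonneg_of_hpart_rc (w : Sym2 V → unitInterval) {q : ℝ} (hq : 1 ≤ q) (hw : ∀ e, 0 < w e ∧ w e < 1) (x : V)
    (Y : Set V) (D : List V) (o v : V) (hnd : D.Nodup) (hD : ∀ d ∈ D, d ≠ x ∧ d ∉ Y ∧ d ≠ o ∧ d ≠ v)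
    {g : Set (Sym2 V) → ℝ} (hg : Monotone g) (hΦ : Monotone (phiFK w q x Y g))
    (hIH : ∀ (pre : List V) (d : V) (ds' : List V), D = pre ++ d :: ds' →
      ∀ h : Set (Sym2 V) → ℝ, Monotone h → (∀ C, 0 ≤ h C) →
        0 ≤ cshMarginμ (rcMeasureW w q ∅) d (insert x Y ∪ {e | e ∈ pre}) ds' o v h)
    (hHP : 0 ≤ ∫ ω in {ω : BondConfig V | ∀ y ∈ Y, ¬ (openGraph ω).Reachable x y},
        (((∫ η in (⋃ t ∈ insert x D.toFinset, openConn o t), g (openEdgeCluster η x)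
              ∂(rcMeasureW (delW w {e | ∃ z ∈ e, ∃ y ∈ Y, (openGraph ω).Reachable y z}) q ∅)) -
            (rcMeasureW (delW w {e | ∃ z ∈ e, ∃ y ∈ Y, (openGraph ω).Reachable y z}) q ∅).real
                (⋃ t ∈ insert x D.toFinset, openConn o t) *
              (∫ η, g (openEdgeCluster η x)
                ∂(rcMeasureW (delW w {e | ∃ z ∈ e, ∃ y ∈ Y, (openGraph ω).Reachable y z}) q ∅))) -
          obsConstμ (rcMeasureW w q ∅) o v (insert x Y ∪ {d | d ∈ D}) *
            ((∫ η in (⋃ t ∈ insert x D.toFinset, openConn v t), g (openEdgeCluster η x)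
              ∂(rcMeasureW (delW w {e | ∃ z ∈ e, ∃ y ∈ Y, (openGraph ω).Reachable y z}) q ∅)) -
            (rcMeasureW (delW w {e | ∃ z ∈ e, ∃ y ∈ Y, (openGraph ω).Reachable y z}) q ∅).real
                (⋃ t ∈ insert x D.toFinset, openConn v t) *
              (∫ η, g (openEdgeCluster η x)
                ∂(rcMeasureW (delW w {e | ∃ z ∈ e, ∃ y ∈ Y, (openGraph ω).Reachable y z}) q ∅))))
        ∂(rcMeasureW w q ∅)) :
    0 ≤ ∫ ω in {ω : BondConfig V | ∀ y ∈ Y, ¬ (openGraph ω).Reachable x y},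
        CSH.cshMarg (decoyListμ (rcMeasureW w q ∅) (insert x Y) D) (obsConstμ (rcMeasureW w q ∅) o v (insert x Y ∪ {d | d ∈ D})) o v
          (fun u => (∫ η in (openConn x u : Set (BondConfig V)), g (openEdgeCluster η x)
                ∂(rcMeasureW (delW w {e | ∃ z ∈ e, ∃ y ∈ Y, (openGraph ω).Reachable y z}) q ∅)) -
              (∫ η, g (openEdgeCluster η x)
                ∂(rcMeasureW (delW w {e | ∃ z ∈ e, ∃ y ∈ Y, (openGraph ω).Reachable y z}) q ∅)) *
              (rcMeasureW (delW w {e | ∃ z ∈ e, ∃ y ∈ Y, (openGraph ω).Reachable y z}) q ∅).real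
                (openConn x u : Set (BondConfig V)))
        ∂(rcMeasureW w q ∅) := by
  have hq0 : 0 < q := one_pos.trans_le hq
  rw [within_unfold_rc w hq0 hw x Y D o v hnd hD g]
  have hsub := subTFK_comb_nonneg w hq x Y D o v hg hΦ hIH D [] (by simp)
  have hS0 : ({x} ∪ {e | e ∈ ([] : List V)} : Set V) = {x} := by ext u; simp
  rw [hS0] at hsub
  exact add_nonneg hHP hsub

/-! ### Lemma H_FK as a named hypothesis, and the assembly -/

/-- **LEMMA H FOR THE RANDOM-CLUSTER MEASURE as a statement** (parametrised by `q`; NOT asserted): the H-part of the unfolding is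
nonnegative — for non-degenerate parameters, owner `x`, avoided set `Y`, marker set `S ∋ x`, observers `o`, `v ∉ S ∪ Y`, monotone `g ≥ 0`:
`0 ≤ ∫_{x↮Y} [Cov_{φ^ω}(g(C_x), 1{o ↔ S}) − p·Cov_{φ^ω}(g(C_x), 1{v ↔ S})] dφ`, `p = φ(o↔v | v ↮ S ∪ Y)`, worlds `φ^ω = rcMeasureW (delW w A_Y(ω)) q ∅`
(the exact FK shape of png-lead's `CSH.hpart_nonneg`; at `q = 1` a tree theorem via (K6) + (Htw); for `q > 1` it is (K6)_rc (tree,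
`FK.covTransfer_relaySet_edge_rc`) + (Htw)_FK (open, bschramm/FK-Q2.md §12.6(c))).
(transcription of the cell memo prim-hp-8 PROOF-S5-ALL-R.md §3.4, FK-parametrised) [cite: VandenbergHaggstromKahn2005, Thm. 1.4 (p. 7), §2.1 (pp. 9–13)] -/
def HpartFK (q : ℝ) : Prop :=
  ∀ (n : ℕ) (w : Sym2 (Fin n) → unitInterval), (∀ e, 0 < w e ∧ w e < 1) →
    ∀ (x : Fin n) (Y : Set (Fin n)) (S : Finset (Fin n)), x ∈ S → ∀ (o v : Fin n), v ∉ S → v ∉ Y →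
    ∀ g : Set (Sym2 (Fin n)) → ℝ, Monotone g → (∀ C, 0 ≤ g C) →
    0 ≤ ∫ ω in {ω : BondConfig (Fin n) | ∀ y ∈ Y, ¬ (openGraph ω).Reachable x y},
      (((∫ η in (⋃ t ∈ S, openConn o t), g (openEdgeCluster η x)
            ∂(rcMeasureW (delW w {e | ∃ z ∈ e, ∃ y ∈ Y, (openGraph ω).Reachable y z}) q ∅)) -
          (rcMeasureW (delW w {e | ∃ z ∈ e, ∃ y ∈ Y, (openGraph ω).Reachable y z}) q ∅).real (⋃ t ∈ S, openConn o t) *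
            (∫ η, g (openEdgeCluster η x)
              ∂(rcMeasureW (delW w {e | ∃ z ∈ e, ∃ y ∈ Y, (openGraph ω).Reachable y z}) q ∅))) -
        obsConstμ (rcMeasureW w q ∅) o v (↑S ∪ Y) *
          ((∫ η in (⋃ t ∈ S, openConn v t), g (openEdgeCluster η x)
              ∂(rcMeasureW (delW w {e | ∃ z ∈ e, ∃ y ∈ Y, (openGraph ω).Reachable y z}) q ∅)) -
            (rcMeasureW (delW w {e | ∃ z ∈ e, ∃ y ∈ Y, (openGraph ω).Reachable y z}) q ∅).real (⋃ t ∈ S, openConn v t) *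
              (∫ η, g (openEdgeCluster η x)
                ∂(rcMeasureW (delW w {e | ∃ z ∈ e, ∃ y ∈ Y, (openGraph ω).Reachable y z}) q ∅))))
      ∂(rcMeasureW w q ∅)

/-- **THE FK HIERARCHY FROM THE TWO LOCATED STATEMENTS**: for `q ≥ 1`, `FK.PhiFKMonotone q` (Lemma Φ(b) for `φ_{w,q}`) and `FK.HpartFK q`
(Lemma H for `φ_{w,q}`) imply `FK.CSHFK q` — memo Theorem 1 for the random-cluster measure.  Assembly = the induction skeleton
`FK.cshFK_of_unfold` (Lemma T_rc + MDL(X)_FK, tree) with its unfolding step `hU` discharged by Lemma U_FK (`FK.within_nonneg_of_hpart_rc`,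
this port) from the lower levels, `hΦ` and `hH`.  NOTHING is asserted about the two hypotheses for `q ≠ 1`.
[cite: VandenbergHaggstromKahn2005, §2.1 (pp. 9–13)] [cite: KozmaNitzan2024, Conj. 4 (p. 32)] -/
theorem cshFK_of_hpartFK_of_phiFKMonotone {q : ℝ} (hq : 1 ≤ q) (hΦ : PhiFKMonotone q) (hH : HpartFK q) : CSHFK q := by
  refine cshFK_of_unfold hq fun n w hw x Y D o v _hxY _ho hv _hov _hne hnd hdis hIH g hg hg0 => ?_
  have hD' : ∀ d ∈ D, d ≠ x ∧ d ∉ Y ∧ d ≠ o ∧ d ≠ v := fun d hd => by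
    obtain ⟨h1, h2, h3⟩ := hdis d hd
    rw [mem_insert_iff, not_or] at h1
    exact ⟨h1.1, h1.2, h2, h3⟩
  refine within_nonneg_of_hpart_rc w hq hw x Y D o v hnd hD' hg (hΦ n w x Y g hg) hIH ?_
  have hv' : v ≠ x ∧ v ∉ Y := by rwa [mem_insert_iff, not_or] at hv
  have hvS : v ∉ insert x D.toFinset := by
    rw [Finset.mem_insert, List.mem_toFinset, not_or]
    exact ⟨hv'.1, fun h => (hdis v h).2.2 rfl⟩
  have hS : ((↑(insert x D.toFinset) : Set (Fin n)) ∪ Y) = insert x Y ∪ {d | d ∈ D} := by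
    ext u
    simp only [Finset.coe_insert, mem_union, mem_insert_iff, Finset.mem_coe, List.mem_toFinset, mem_setOf_eq]
    tauto
  have key := hH n w hw x Y (insert x D.toFinset) (Finset.mem_insert_self x _) o v hvS hv'.2 g hg hg0
  rw [hS] at key
  convert key using 20

/-! ### `q = 1` sanity: Lemma H holds (png-lead's `CSH.hpart_nonneg`) -/

/-- **`q = 1`: Lemma H holds** — `FK.HpartFK 1` is png-lead's `CSH.hpart_nonneg` (the worlds `rcMeasureW (delW w A) 1 ∅` are the
product worlds `prodBernoulli (w zeroed on A)`; builds on p205010 (kernel theorem, internal audit signed; external expert review pending)).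
[cite: VandenbergHaggstromKahn2005, Thm. 1.4 (p. 7), §2.1 (pp. 9–13)] -/
theorem hpartFK_one : HpartFK 1 := by
  intro n w hw x Y S hxS o v hvS hvY g hg hg0
  have key := CSH.hpart_nonneg w hw x Y S hxS o v hvS hvY g hg hg0
  have e : ∀ ω : BondConfig (Fin n), delW w {e : Sym2 (Fin n) | ∃ z ∈ e, ∃ y ∈ Y, (openGraph ω).Reachable y z} =
      fun e => if (∃ z ∈ e, ∃ y ∈ Y, (openGraph ω).Reachable y z) then (0 : unitInterval) else w e := by
    intro ω; funext e'
    by_cases h : ∃ z ∈ e', ∃ y ∈ Y, (openGraph ω).Reachable y z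
    · rw [if_pos h]; simp only [delW, Set.mem_setOf_eq, if_pos h]
    · rw [if_neg h]; simp only [delW, Set.mem_setOf_eq, if_neg h]
  simp only [rcMeasureW_one, obsConstμ_prodBernoulli, e]
  -- the two statements agree up to the (subsingleton) decidability instances inside the world weights
  convert key using 20

end FK

end Summit.CriticalPhenomena.PercolationContinuityZ3.Theorems

end
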